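import Summits.PneNP.PneNP.Theorems.ConstantBand.Negative.LoadBearing
import Summits.PneNP.PneNP.Theorems.SingleThreshold.Negative.Locality
import Summits.PneNP.PneNP.Theorems.SliceACZero.Negative.DeltaBeforeK
import Literature.Computability.Complexity.CliqueThresholdBounds

/-!
# `SliceTarget` (stmt-PneNP-2832), line `Sketch-ideator3-r1` — stub T4 `FibreCliqueUpper`

First moment on a sub-box of a central slice (`k ≥ 3` fixed, `n` large, `j` central, `#F ≤ 3n`, pattern
`ρ`): at least HALF of the fibre `Φ(ρ) = {x : e(x) = j, x|_F = ρ|_F}` has NO `k`-clique avoiding `F`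
(`cliqueFn n k (zeroOn F x) = false`). With `N = C(n,2)`, `K = C(k,2)`, `r = #{e ∈ F : ρ e = 1}`,
`N' = N - #F`, `j' = j - r`: `le_card_fibre` (`C(N', j') ≤ #Φ(ρ)`: "`ρ` on `F`, a `j'`-subset of `Fᶜ`
off `F`" injects), `card_fibre_supset_le` (members switching on a fixed `S ⊆ Fᶜ` are `≤ C(N'-#S, j'-#S)`:
on-set minus `F` injects into the `j'`-subsets of `Fᶜ` containing `S`), `card_fibre_clique_le` (a
`k`-clique of `x ∖ F` is a `k`-set `A` with `K_A ⊆ Fᶜ` on in `x`; with the ratio bound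
`C(N'-K, j'-K) N'^K ≤ C(N', j') j'^K`: `#{x ∈ Φ(ρ) : CLIQUE_k(x ∖ F)} ≤ C(n,k) (j'/N')^K #Φ(ρ)`), and
`stub_fibreCliqueUpper`: on the central window `j'/N' ≤ j/(N - 3n) ≤ p_c u_n`, `p_c = n^{-2/(k-1)}`,
`u_n = (1 + m^{-1/4})(1 + 12/n) → 1` (`m = thr k n → ∞`), so `C(n,k)(j'/N')^K ≤ u_n^K/k! < 3/k! ≤ 1/2`.
The window bookkeeping inside `tendsto_thr_atTop` (`m_k(n) ≥ (n-1)/2 - 1`) is adapted from the standing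
disprover's work file `Cruxes/SliceTarget/Disproof.lean` (`thr_ge`, not importable; the same bound is
`thr_ge'` of the sibling stub-T6 file `OneSliceSliceTargetTransfer.lean`). Stub T3 (lower bound) is NOT here.
-/

set_option linter.dupNamespace false

namespace Summit.PneNP.PneNP.Cruxes.SliceTarget.Ideator3Line

open Literature.Computability.Complexity Finset Filter Classical
open scoped Topology
open Summit.PneNP.PneNP.Theorems.ConstantBand.Negative (Edge thr Central slice)
open Summit.PneNP.PneNP.Theorems.SingleThreshold.Negative (Edges zeroOn pc pc_nonneg pc_le_one tendsto_pc
  firstMoment_pc_le)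
open Summit.PneNP.PneNP.Theorems.SliceACZero.Negative (sliceCard sliceCard_eq card_slice_supset_le
  choose_sub_mul_pow_le_choose_mul_pow)

noncomputable section

variable {n : ℕ}

/-! ## Bookkeeping: slices, on-sets, `zeroOn`; the two support-transport counts -/

/-- Membership in a slice: `x ∈ slice n j ↔ e(x) = j`. [folklore] -/
theorem mem_slice_iff {j : ℕ} {x : Edge n → Bool} : x ∈ slice n j ↔ edgeCount x = j := by
  simp [Theorems.ConstantBand.Negative.slice]

/-- The on-set of an edge vector has `e(x)` elements (definitional). [folklore] -/
theorem card_onSet_eq_edgeCount (x : Edge n → Bool) : #(onSet x) = edgeCount x := rfl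

/-- `(x ∖ F) e = 1` iff `e ∉ F` and `x e = 1`. [folklore] -/
theorem zeroOn_eq_true_iff {F : Finset (Edge n)} {x : Edge n → Bool} {e : Edge n} :
    zeroOn F x e = true ↔ e ∉ F ∧ x e = true := by
  by_cases h : e ∈ F <;> simp [zeroOn, h]

/-- On a fibre over `F` the on-set meets `F` in the on-set of the pattern. [folklore] -/
theorem onSet_inter_eq {F : Finset (Edge n)} {ρ x : Edge n → Bool} (hx : ∀ e ∈ F, x e = ρ e) :
    onSet x ∩ F = F.filter fun e => ρ e = true := by
  ext e
  simp only [mem_inter, mem_onSet, mem_filter]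
  exact ⟨fun h => ⟨h.2, (hx e h.2).symm.trans h.1⟩, fun h => ⟨(hx e h.1).trans h.2, h.1⟩⟩

/-- On the fibre of `ρ` in the slice `j`, on-set-minus-`F` is a `(j - r)`-subset of `Fᶜ`, and `r ≤ j`
(`r = #{e ∈ F : ρ e = 1}`). [folklore] -/
theorem onSet_sdiff_mem {j : ℕ} {F : Finset (Edge n)} {ρ x : Edge n → Bool}
    (hx : x ∈ (slice n j).filter fun x => ∀ e ∈ F, x e = ρ e) :
    onSet x \ F ∈ powersetCard (j - #(F.filter fun e => ρ e = true)) Fᶜ ∧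
      #(F.filter fun e => ρ e = true) ≤ j := by
  rw [mem_filter, mem_slice_iff] at hx
  have hcard := card_sdiff_add_card_inter (onSet x) F
  rw [onSet_inter_eq hx.2, card_onSet_eq_edgeCount, hx.1] at hcard
  exact ⟨mem_powersetCard.2 ⟨fun e he => mem_compl.2 (Finset.mem_sdiff.1 he).2, by omega⟩, by omega⟩

/-- On-set-minus-`F` is injective on a fibre over `F`. [folklore] -/
theorem onSet_sdiff_injOn (j : ℕ) (F : Finset (Edge n)) (ρ : Edge n → Bool) :
    Set.InjOn (fun x : Edge n → Bool => onSet x \ F)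
      ↑((slice n j).filter fun x => ∀ e ∈ F, x e = ρ e) := by
  intro x hx y hy hxy
  have hxy' : onSet x \ F = onSet y \ F := hxy
  have hx' := (mem_filter.1 (mem_coe.1 hx)).2
  have hy' := (mem_filter.1 (mem_coe.1 hy)).2
  funext e
  by_cases he : e ∈ F
  · exact (hx' e he).trans (hy' e he).symm
  · have h : e ∈ onSet x \ F ↔ e ∈ onSet y \ F := by rw [hxy']
    simp only [Finset.mem_sdiff, mem_onSet, he, not_false_eq_true, and_true] at h
    exact Bool.eq_iff_iff.2 h

/-- **Lower count of a fibre**: `C(N - #F, j - r) ≤ #Φ(ρ)` once `r ≤ j` — the vector that is `ρ` on `F` and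
the indicator of a `(j - r)`-subset `T ⊆ Fᶜ` off `F` lies in the fibre, injectively in `T`. [folklore] -/
theorem le_card_fibre {j : ℕ} (F : Finset (Edge n)) (ρ : Edge n → Bool)
    (hr : #(F.filter fun e => ρ e = true) ≤ j) :
    (n.choose 2 - #F).choose (j - #(F.filter fun e => ρ e = true)) ≤
      #((slice n j).filter fun x => ∀ e ∈ F, x e = ρ e) := by
  set r := #(F.filter fun e => ρ e = true) with hr_def
  have hc : #(powersetCard (j - r) Fᶜ) = (n.choose 2 - #F).choose (j - r) := by
    rw [card_powersetCard, card_compl, card_edgeSet_top_fin]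
  have key : ∀ T ∈ (↑(powersetCard (j - r) Fᶜ) : Set (Finset (Edge n))), ∀ e ∈ T, e ∉ F :=
    fun T hT e he heF => (mem_compl.1 ((mem_powersetCard.1 (mem_coe.1 hT)).1 he)) heF
  rw [← hc]
  refine card_le_card_of_injOn
    (fun T : Finset (Edge n) => fun e => if e ∈ F then ρ e else decide (e ∈ T)) ?_ ?_
  · intro T hT
    beta_reduce
    have hTF := key T hT
    have hTc := (mem_powersetCard.1 (mem_coe.1 hT)).2
    rw [mem_coe, mem_filter, mem_slice_iff]
    refine ⟨?_, fun e he => by simp [he]⟩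
    have honT : onSet (fun e => if e ∈ F then ρ e else decide (e ∈ T)) =
        (F.filter fun e => ρ e = true) ∪ T := by
      ext e
      rw [mem_onSet, mem_union, mem_filter]
      by_cases he : e ∈ F
      · have heT : e ∉ T := fun heT => hTF e heT he
        simp [he, heT]
      · simp [he]
    rw [← card_onSet_eq_edgeCount, honT, card_union_of_disjoint, hTc]
    · omega
    · exact disjoint_left.2 fun e he heT => hTF e heT (mem_filter.1 he).1
  · intro T hT T' hT' hTT'
    ext e
    by_cases he : e ∈ F
    · exact ⟨fun h => absurd he (key T hT e h), fun h => absurd he (key T' hT' e h)⟩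
    · simpa [he] using congrFun hTT' e

/-- **Members of a fibre switching on a fixed `S ⊆ Fᶜ`** number at most `C(N - #F - #S, j - r - #S)`
when `#S ≤ j - r`: on-set-minus-`F` injects them into the `(j - r)`-subsets of `Fᶜ` containing `S`,
counted by `card_filter_supset_powersetCard_le`. [folklore] -/
theorem card_fibre_supset_le {j : ℕ} (F : Finset (Edge n)) (ρ : Edge n → Bool) (S : Finset (Edge n))
    (hSF : ∀ e ∈ S, e ∉ F) (hSj : #S ≤ j - #(F.filter fun e => ρ e = true)) :
    #(((slice n j).filter fun x => ∀ e ∈ F, x e = ρ e).filter fun x => ∀ e ∈ S, x e = true) ≤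
      (n.choose 2 - #F - #S).choose (j - #(F.filter fun e => ρ e = true) - #S) := by
  set r := #(F.filter fun e => ρ e = true) with hr_def
  calc #(((slice n j).filter fun x => ∀ e ∈ F, x e = ρ e).filter fun x => ∀ e ∈ S, x e = true)
      ≤ #((powersetCard (j - r) Fᶜ).filter fun Q => S ⊆ Q) := by
        refine card_le_card_of_injOn (fun x : Edge n → Bool => onSet x \ F) ?_ ?_
        · intro x hx
          beta_reduce
          rw [mem_coe, mem_filter] at hx ⊢
          refine ⟨(onSet_sdiff_mem hx.1).1, fun e he => ?_⟩
          rw [Finset.mem_sdiff, mem_onSet]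
          exact ⟨hx.2 e he, hSF e he⟩
        · exact (onSet_sdiff_injOn j F ρ).mono (coe_subset.2 (filter_subset _ _))
    _ ≤ (#Fᶜ - #S).choose (j - r - #S) := card_filter_supset_powersetCard_le _ _ hSj
    _ = (n.choose 2 - #F - #S).choose (j - r - #S) := by rw [card_compl, card_edgeSet_top_fin]

/-! ## First moment on the fibre -/

/-- **One piece of the union bound**: for a `k`-set `A` whose clique edges `K_A` avoid `F`, the members of
`Φ(ρ)` switching on all of `K_A` number at most `((j - r)/(N - #F))^{C(k,2)} · #Φ(ρ)` (`k ≥ 2`; count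
`C(N'-K, j'-K)` against `C(N', j') ≤ #Φ(ρ)`, and `C(N'-K, j'-K) N'^K ≤ C(N', j') j'^K`). [folklore] -/
theorem card_fibre_cliqueVec_le {j k : ℕ} (hk : 2 ≤ k) (F : Finset (Edge n)) (ρ : Edge n → Bool)
    (A : Finset (Fin n)) (hA : #A = k) (hAF : ∀ e : Edge n, cliqueVec A e = true → e ∉ F) :
    (#(((slice n j).filter fun x => ∀ e ∈ F, x e = ρ e).filter
        fun x => ∀ e : Edge n, cliqueVec A e = true → x e = true) : ℝ) ≤
      (((j - #(F.filter fun e => ρ e = true) : ℕ) : ℝ) / ((n.choose 2 - #F : ℕ) : ℝ)) ^ (k.choose 2) *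
        #((slice n j).filter fun x => ∀ e ∈ F, x e = ρ e) := by
  set r := #(F.filter fun e => ρ e = true) with hr_def
  set Φ := (slice n j).filter fun x => ∀ e ∈ F, x e = ρ e with hΦ_def
  set K := k.choose 2 with hK_def
  set N' := n.choose 2 - #F with hN'_def
  set j' := j - r with hj'_def
  set q : ℝ := ((j' : ℕ) : ℝ) / ((N' : ℕ) : ℝ) with hq_def
  have hq0 : 0 ≤ q := div_nonneg (Nat.cast_nonneg _) (Nat.cast_nonneg _)
  set S := univ.filter fun e : Edge n => cliqueVec A e = true with hS_def
  have hScard : #S = K := by rw [hS_def, card_filter_cliqueVec, hA]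
  have hSF : ∀ e ∈ S, e ∉ F := fun e he => hAF e (mem_filter.1 he).2
  have hGS : (Φ.filter fun x => ∀ e : Edge n, cliqueVec A e = true → x e = true) =
      Φ.filter fun x => ∀ e ∈ S, x e = true := by
    refine filter_congr fun x _ => ?_
    simp [hS_def]
  rw [hGS]
  rcases (Φ.filter fun x => ∀ e ∈ S, x e = true).eq_empty_or_nonempty with hGe | ⟨x₀, hx₀⟩
  · rw [hGe, card_empty, Nat.cast_zero]
    exact mul_nonneg (pow_nonneg hq0 _) (Nat.cast_nonneg _)
  -- a member `x₀` witnesses `r ≤ j` and `K ≤ j' ≤ N'`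
  obtain ⟨hx₀Φ, hx₀S⟩ := mem_filter.1 hx₀
  obtain ⟨hmem, hrj⟩ := onSet_sdiff_mem hx₀Φ
  obtain ⟨hsubc, hcard⟩ := mem_powersetCard.1 hmem
  have hj'N' : j' ≤ N' := by
    have h := card_le_card hsubc
    rwa [hcard, card_compl, card_edgeSet_top_fin] at h
  have hKj' : K ≤ j' := by
    have h := card_le_card (show S ⊆ onSet x₀ \ F from
      fun e he => Finset.mem_sdiff.2 ⟨(mem_onSet _ _).2 (hx₀S e he), hSF e he⟩)
    rwa [hScard, hcard] at h
  have hK1 : 1 ≤ K := Nat.choose_pos hk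
  have hN'pos : (0 : ℝ) < ((N' : ℕ) : ℝ) := by exact_mod_cast (show 0 < N' by omega)
  have h1 : #(Φ.filter fun x => ∀ e ∈ S, x e = true) ≤ (N' - K).choose (j' - K) := by
    have h := card_fibre_supset_le (j := j) F ρ S hSF (hScard.le.trans hKj')
    rwa [hScard] at h
  have h2 : (N' - K).choose (j' - K) * N' ^ K ≤ N'.choose j' * j' ^ K :=
    choose_sub_mul_pow_le_choose_mul_pow hKj' hj'N'
  have h3 : N'.choose j' ≤ #Φ := le_card_fibre F ρ hrj
  calc (#(Φ.filter fun x => ∀ e ∈ S, x e = true) : ℝ) ≤ (((N' - K).choose (j' - K) : ℕ) : ℝ) := by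
        exact_mod_cast h1
    _ ≤ ((N'.choose j' : ℕ) : ℝ) * q ^ K := by
        rw [hq_def, div_pow, ← mul_div_assoc, le_div_iff₀ (pow_pos hN'pos _)]
        exact_mod_cast h2
    _ ≤ (#Φ : ℝ) * q ^ K := mul_le_mul_of_nonneg_right (by exact_mod_cast h3) (pow_nonneg hq0 _)
    _ = q ^ K * #Φ := mul_comm _ _

/-- **First moment on the fibre**: the members of `Φ(ρ)` having a `k`-clique that AVOIDS `F`
(`CLIQUE_k(x ∖ F) = 1`) number at most `C(n,k) · ((j - r)/(N - #F))^{C(k,2)} · #Φ(ρ)` (`k ≥ 2`): a `k`-clique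
of `x ∖ F` is a `k`-set `A` with `K_A ⊆ Fᶜ` on in `x` (union bound over `A`, `card_fibre_cliqueVec_le`).
[folklore] -/
theorem card_fibre_clique_le (j : ℕ) (F : Finset (Edge n)) (ρ : Edge n → Bool) {k : ℕ} (hk : 2 ≤ k) :
    (#((slice n j).filter fun x => (∀ e ∈ F, x e = ρ e) ∧ cliqueFn n k (zeroOn F x) = true) : ℝ) ≤
      (n.choose k : ℝ) * (((j - #(F.filter fun e => ρ e = true) : ℕ) : ℝ) /
          ((n.choose 2 - #F : ℕ) : ℝ)) ^ (k.choose 2) *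
        #((slice n j).filter fun x => ∀ e ∈ F, x e = ρ e) := by
  set r := #(F.filter fun e => ρ e = true) with hr_def
  set Φ := (slice n j).filter fun x => ∀ e ∈ F, x e = ρ e with hΦ_def
  set K := k.choose 2 with hK_def
  set q : ℝ := (((j - r : ℕ) : ℕ) : ℝ) / ((n.choose 2 - #F : ℕ) : ℝ) with hq_def
  have hq0 : 0 ≤ q := div_nonneg (Nat.cast_nonneg _) (Nat.cast_nonneg _)
  -- index set: the `k`-sets whose clique edges avoid `F`
  set T := (powersetCard k (univ : Finset (Fin n))).filter fun A =>
    ∀ e : Edge n, cliqueVec A e = true → e ∉ F with hT_def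
  have hsub : ((slice n j).filter fun x => (∀ e ∈ F, x e = ρ e) ∧ cliqueFn n k (zeroOn F x) = true) ⊆
      T.biUnion fun A => Φ.filter fun x => ∀ e : Edge n, cliqueVec A e = true → x e = true := by
    intro x hx
    obtain ⟨hxs, hxρ, hcl⟩ := mem_filter.1 hx
    have hne := (cliqueCount_ne_zero_iff (zeroOn F x)).2 hcl
    rw [Ne, cliqueCount_eq_zero_iff_forall] at hne
    push Not at hne
    obtain ⟨A, hA, hAx⟩ := hne
    have hAx' : ∀ e : Edge n, cliqueVec A e = true → e ∉ F ∧ x e = true :=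
      fun e he => zeroOn_eq_true_iff.1 (hAx e he)
    rw [mem_biUnion]
    refine ⟨A, mem_filter.2 ⟨hA, fun e he => (hAx' e he).1⟩,
      mem_filter.2 ⟨?_, fun e he => (hAx' e he).2⟩⟩
    exact mem_filter.2 ⟨hxs, hxρ⟩
  have hterm : ∀ A ∈ T,
      (#(Φ.filter fun x => ∀ e : Edge n, cliqueVec A e = true → x e = true) : ℝ) ≤ q ^ K * #Φ := by
    intro A hAT
    obtain ⟨hA, hAF⟩ := mem_filter.1 hAT
    exact card_fibre_cliqueVec_le hk F ρ A (mem_powersetCard.1 hA).2 hAF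
  have hT : (#T : ℝ) ≤ n.choose k := by
    have h : #T ≤ #(powersetCard k (univ : Finset (Fin n))) := card_le_card (filter_subset _ _)
    rw [card_powersetCard, card_univ, Fintype.card_fin] at h
    exact_mod_cast h
  calc (#((slice n j).filter fun x => (∀ e ∈ F, x e = ρ e) ∧ cliqueFn n k (zeroOn F x) = true) : ℝ)
      ≤ #(T.biUnion fun A => Φ.filter fun x => ∀ e : Edge n, cliqueVec A e = true → x e = true) := by
        exact_mod_cast card_le_card hsub
    _ ≤ ∑ A ∈ T, (#(Φ.filter fun x => ∀ e : Edge n, cliqueVec A e = true → x e = true) : ℝ) := by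
        exact_mod_cast card_biUnion_le
    _ ≤ ∑ _A ∈ T, q ^ K * #Φ := sum_le_sum hterm
    _ = #T * (q ^ K * #Φ) := by rw [sum_const, nsmul_eq_mul]
    _ ≤ (n.choose k : ℝ) * (q ^ K * #Φ) :=
        mul_le_mul_of_nonneg_right hT (mul_nonneg (pow_nonneg hq0 _) (Nat.cast_nonneg _))
    _ = (n.choose k : ℝ) * q ^ K * #Φ := by ring

/-- The fibre splits by the value of `CLIQUE_k(x ∖ F)`. [folklore] -/
theorem card_fibre_split (j k : ℕ) (F : Finset (Edge n)) (ρ : Edge n → Bool) :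
    (#((slice n j).filter fun x => (∀ e ∈ F, x e = ρ e) ∧ cliqueFn n k (zeroOn F x) = true) : ℝ) +
        #((slice n j).filter fun x => (∀ e ∈ F, x e = ρ e) ∧ cliqueFn n k (zeroOn F x) = false) =
      #((slice n j).filter fun x => ∀ e ∈ F, x e = ρ e) := by
  have h1 : ((slice n j).filter fun x => (∀ e ∈ F, x e = ρ e) ∧ cliqueFn n k (zeroOn F x) = true) =
      ((slice n j).filter fun x => ∀ e ∈ F, x e = ρ e).filter
        fun x => cliqueFn n k (zeroOn F x) = true := by
    ext x; simp only [mem_filter, and_assoc]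
  have h2 : ((slice n j).filter fun x => (∀ e ∈ F, x e = ρ e) ∧ cliqueFn n k (zeroOn F x) = false) =
      ((slice n j).filter fun x => ∀ e ∈ F, x e = ρ e).filter
        fun x => ¬ cliqueFn n k (zeroOn F x) = true := by
    ext x; simp only [mem_filter, and_assoc, Bool.not_eq_true]
  rw [h1, h2]
  exact_mod_cast card_filter_add_card_filter_not _

/-! ## Window bookkeeping and the stub -/

-- the bound `(n-1)/2 - 1 ≤ thr k n` is adapted from Cruxes/SliceTarget/Disproof.lean (`thr_ge`)
/-- `m_k(n) → ∞` (as a real sequence), `k ≥ 3`: `m_k(n) ≥ C(n,2)·n^{-1} - 1 = (n-1)/2 - 1` since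
`n^{-2/(k-1)} ≥ n^{-1}` for `k ≥ 3`. [folklore] -/
theorem tendsto_thr_atTop {k : ℕ} (hk : 3 ≤ k) : Tendsto (fun n : ℕ => (thr k n : ℝ)) atTop atTop := by
  have hge : ∀ n : ℕ, 1 ≤ n → ((n : ℝ) - 1) / 2 - 1 ≤ thr k n := by
    intro n hn
    have hn1 : (1 : ℝ) ≤ n := by exact_mod_cast hn
    have hk' : (3 : ℝ) ≤ k := by exact_mod_cast hk
    have hinv : (n : ℝ)⁻¹ ≤ (n : ℝ) ^ (-(2 : ℝ) / ((k : ℝ) - 1)) := by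
      rw [← Real.rpow_neg_one]
      apply Real.rpow_le_rpow_of_exponent_le hn1
      rw [neg_div, neg_le_neg_iff, div_le_one (by linarith)]
      linarith
    have hT : ((n : ℝ) - 1) / 2 ≤ (n.choose 2 : ℕ) * (n : ℝ) ^ (-(2 : ℝ) / ((k : ℝ) - 1)) := by
      have hn0 : (n : ℝ) ≠ 0 := by exact_mod_cast (show n ≠ 0 by omega)
      calc ((n : ℝ) - 1) / 2 = (n.choose 2 : ℕ) * (n : ℝ)⁻¹ := by
            rw [Nat.cast_choose_two]
            field_simp
        _ ≤ _ := mul_le_mul_of_nonneg_left hinv (Nat.cast_nonneg _)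
    have hfl := Nat.lt_floor_add_one (((n.choose 2 : ℕ) : ℝ) * (n : ℝ) ^ (-(2 : ℝ) / ((k : ℝ) - 1)))
    rw [thr]
    linarith
  refine tendsto_atTop_atTop.2 fun b => ?_
  obtain ⟨i, hi⟩ := exists_nat_ge (2 * b + 3)
  refine ⟨i + 1, fun n hn => ?_⟩
  have hni : (i : ℝ) + 1 ≤ n := by exact_mod_cast hn
  have h := hge n (by omega)
  linarith

/-- **T4 `FibreCliqueUpper`** (registered stub of line `Sketch-ideator3-r1` for crux `SliceTarget`): for
`k ≥ 3`, eventually in `n`, on every central slice `j`, for every slot set `F` with `#F ≤ 3n` and every pattern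
`ρ`, at least HALF of the fibre `{x ∈ slice_j : x|_F = ρ|_F}` has NO `k`-clique avoiding `F`. First moment:
`#{clique} ≤ C(n,k) (j'/N')^{C(k,2)} #Φ` (`card_fibre_clique_le`), `j'/N' ≤ j/(C(n,2) - 3n) ≤ p_c u_n` with
`u_n = (1 + m_k(n)^{-1/4})(1 + 12/n) → 1`, and `C(n,k) (p_c u_n)^{C(k,2)} ≤ u_n^{C(k,2)}/k! < 3/k! ≤ 1/2`.
[folklore] -/
theorem stub_fibreCliqueUpper :
    ∀ k : ℕ, 3 ≤ k → ∀ᶠ n : ℕ in atTop, ∀ j : ℕ, Central k n j →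
      ∀ F : Finset (Edge n), #F ≤ 3 * n → ∀ ρ : Edge n → Bool,
        (1 / 2 : ℝ) * #((slice n j).filter fun x => ∀ e ∈ F, x e = ρ e) ≤
          #((slice n j).filter fun x => (∀ e ∈ F, x e = ρ e) ∧ cliqueFn n k (zeroOn F x) = false) := by
  intro k hk
  have hk2 : 2 ≤ k := by omega
  -- the correction factor `u_n = (1 + m^{-1/4}) (1 + 12/n)` tends to `1`, so `u_n ^ K < 3` eventually
  have h0 : Tendsto (fun n : ℕ => (thr k n : ℝ) ^ (-(1 / 4 : ℝ))) atTop (𝓝 0) :=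
    (tendsto_rpow_neg_atTop (by norm_num)).comp (tendsto_thr_atTop hk)
  have h12 : Tendsto (fun n : ℕ => (12 : ℝ) / n) atTop (𝓝 0) := tendsto_const_div_atTop_nhds_zero_nat 12
  have hu : Tendsto (fun n : ℕ =>
      ((1 + (thr k n : ℝ) ^ (-(1 / 4 : ℝ))) * (1 + 12 / (n : ℝ))) ^ k.choose 2) atTop (𝓝 1) := by
    have h := (((tendsto_const_nhds (x := (1 : ℝ))).add h0).mul
      ((tendsto_const_nhds (x := (1 : ℝ))).add h12)).pow (k.choose 2)
    simpa using h
  have hu3 : ∀ᶠ n : ℕ in atTop,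
      ((1 + (thr k n : ℝ) ^ (-(1 / 4 : ℝ))) * (1 + 12 / (n : ℝ))) ^ k.choose 2 < 3 :=
    hu.eventually (gt_mem_nhds (by norm_num))
  filter_upwards [hu3, eventually_ge_atTop 14, (tendsto_thr_atTop hk).eventually_gt_atTop 0] with n hun hn
    hm0 j hj F hF ρ
  have hn1 : 1 ≤ n := by omega
  have hn0 : (0 : ℝ) < n := by exact_mod_cast (show 0 < n by omega)
  have hn14 : (14 : ℝ) ≤ n := by exact_mod_cast hn
  -- Step 1: counting on the fibre
  have hmom := card_fibre_clique_le j F ρ hk2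
  have hsplit := card_fibre_split j k F ρ
  set r : ℕ := #(F.filter fun e => ρ e = true) with hr_def
  set N : ℕ := n.choose 2 with hN_def
  set q : ℝ := ((j - r : ℕ) : ℝ) / ((N - #F : ℕ) : ℝ) with hq_def
  set u : ℝ := (1 + (thr k n : ℝ) ^ (-(1 / 4 : ℝ))) * (1 + 12 / (n : ℝ)) with hu_def
  -- Step 2: `q ≤ p_c · u`
  have hNval : (N : ℝ) = n * (n - 1) / 2 := by rw [hN_def]; exact Nat.cast_choose_two ℝ n
  have h3N : (3 * n : ℝ) < N := by rw [hNval]; nlinarith [mul_nonneg (sub_nonneg.2 hn14) hn0.le]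
  have hFN : #F < N := by
    have h : ((#F : ℕ) : ℝ) < N := lt_of_le_of_lt (by exact_mod_cast hF) h3N
    exact_mod_cast h
  have hden : (0 : ℝ) < (N : ℝ) - 3 * n := by linarith
  have hq0 : 0 ≤ q := div_nonneg (Nat.cast_nonneg _) (Nat.cast_nonneg _)
  have hq1 : q ≤ (j : ℝ) / ((N : ℝ) - 3 * n) := by
    rw [hq_def, Nat.cast_sub hFN.le]
    have hF' : ((#F : ℕ) : ℝ) ≤ 3 * n := by exact_mod_cast hF
    exact div_le_div₀ (Nat.cast_nonneg _) (by exact_mod_cast Nat.sub_le j r) hden (by linarith)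
  have hs0 : (0 : ℝ) ≤ (thr k n : ℝ) ^ (-(1 / 4 : ℝ)) := Real.rpow_nonneg hm0.le _
  have hjm : (j : ℝ) ≤ (thr k n : ℝ) * (1 + (thr k n : ℝ) ^ (-(1 / 4 : ℝ))) := by
    have h1 : (j : ℝ) - thr k n ≤ (thr k n : ℝ) ^ ((3 : ℝ) / 4) := (abs_sub_le_iff.1 hj).1
    have h34 : (thr k n : ℝ) ^ ((3 : ℝ) / 4) = (thr k n : ℝ) * (thr k n : ℝ) ^ (-(1 / 4 : ℝ)) := by
      rw [show ((3 : ℝ) / 4) = 1 + -(1 / 4 : ℝ) by norm_num, Real.rpow_add hm0, Real.rpow_one]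
    rw [mul_add, mul_one, ← h34]
    linarith
  have hmN : (thr k n : ℝ) ≤ (N : ℝ) * pc n k := by
    rw [hN_def, thr, pc]
    exact Nat.floor_le (by positivity)
  have hratio : (N : ℝ) / ((N : ℝ) - 3 * n) ≤ 1 + 12 / (n : ℝ) := by
    rw [div_le_iff₀ hden]
    have hkey : 12 / (n : ℝ) * ((N : ℝ) - 3 * n) = 6 * (n - 1) - 36 := by
      rw [hNval]
      field_simp
      ring
    rw [add_mul, one_mul, hkey]
    linarith
  have hqu : q ≤ pc n k * u := by
    calc q ≤ (j : ℝ) / ((N : ℝ) - 3 * n) := hq1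
      _ ≤ (N : ℝ) * pc n k * (1 + (thr k n : ℝ) ^ (-(1 / 4 : ℝ))) / ((N : ℝ) - 3 * n) := by
          apply div_le_div_of_nonneg_right _ hden.le
          exact hjm.trans (mul_le_mul_of_nonneg_right hmN (by linarith))
      _ = pc n k * (1 + (thr k n : ℝ) ^ (-(1 / 4 : ℝ))) * ((N : ℝ) / ((N : ℝ) - 3 * n)) := by ring
      _ ≤ pc n k * (1 + (thr k n : ℝ) ^ (-(1 / 4 : ℝ))) * (1 + 12 / (n : ℝ)) :=
          mul_le_mul_of_nonneg_left hratio (mul_nonneg (pc_nonneg n k) (by linarith))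
      _ = pc n k * u := by rw [hu_def]; ring
  -- Step 3: the coefficient is at most `1/2`
  have hu0 : 0 ≤ u := by rw [hu_def]; exact mul_nonneg (by linarith) (by positivity)
  have hcoef : (n.choose k : ℝ) * q ^ k.choose 2 ≤ 1 / 2 := by
    have hfac : (6 : ℝ) ≤ k.factorial := by
      have h : (3 : ℕ).factorial ≤ k.factorial := Nat.factorial_le hk
      exact_mod_cast h
    calc (n.choose k : ℝ) * q ^ k.choose 2 ≤ (n.choose k : ℝ) * (pc n k * u) ^ k.choose 2 :=
          mul_le_mul_of_nonneg_left (pow_le_pow_left₀ hq0 hqu _) (Nat.cast_nonneg _)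
      _ = (n.choose k : ℝ) * pc n k ^ k.choose 2 * u ^ k.choose 2 := by rw [mul_pow, mul_assoc]
      _ ≤ 1 / (k.factorial : ℝ) * u ^ k.choose 2 :=
          mul_le_mul_of_nonneg_right (firstMoment_pc_le hn1 hk2) (pow_nonneg hu0 _)
      _ ≤ 1 / 6 * 3 :=
          mul_le_mul (one_div_le_one_div_of_le (by norm_num) hfac) hun.le (pow_nonneg hu0 _)
            (by norm_num)
      _ = 1 / 2 := by norm_num
  -- Step 4: assemble
  linarith [hmom.trans (mul_le_mul_of_nonneg_right hcoef (Nat.cast_nonneg _))]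

end

end Summit.PneNP.PneNP.Cruxes.SliceTarget.Ideator3Line
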